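import Literature.AnabelianGeometry.EtaleTheta.ConstantMultipleRigidity
import HarnessLib

/-!
# [EtTh] §1, Prop. 1.4 (iii): ANCHORED non-cuspidal points and the corrected value statement

Mochizuki, *The étale theta function …*, Publ. RIMS **45** (2009) [EtTh], §1, Prop. 1.4 (iii), PRIMS PDF
p. 22 (printed 248) [cite: MochizukiEtTh2009, Prop 1.4 (iii) p.22]: "if `L` is a finite extension of `K̈`,
and `y ∈ Ÿ(L)` is a non-cuspidal point, then the restricted classes
`O^×_K̈ · η̈^Θ|_y ∈ H¹(G_L, Δ_Θ) ≅ H¹(G_L, Ẑ(1)) ≅ (L^×)^∧ … lie in `L^× ⊆ (L^×)^∧` and are equal to the values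
`O^×_K̈ · Θ̈(y)`"; and Def. 1.9, p. 29 (the points `τ`, `τ⁻¹`). Layer L2 of the abc-iut cell, seat
abc-iut-L2-t1 (§1 interface owner); ADDITIVE repair file (post-FACT-LIST-freeze, no edit of the frozen
`ThetaCohomology.lean` / `ConstantMultipleRigidity.lean`).

**Why.** Findings F-d1g4-1 (abc-iut-L2-d1) and F-w5d140-3 (abc-iut-w5-d140), kernel-witnessed
(`Discharge/Sec1Prop14iiiValuesVacuity.lean`): the interface record `ThetaSetting.NonCuspidalPoint E`
carries the decomposition group `Dpt`, the coordinate `coord = Ü(y)` and the evaluation map `evalAt` as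
INDEPENDENT data (linked only on constant classes, `evalAt_kum`), so re-coordinatising
`y ↦ (D_y, q̈^{±1}·Ü(y), evalAt)` stays a term of the type and the `∀ y`-statement `Prop14iiiValues E`
(FACT-LIST F-0590) is refuted by the proved functional equation of Prop. 1.4 (ii) whenever a point exists —
it holds only vacuously. In print, `y` is a POINT: `Ü(y)` and the evaluation isomorphism are both
determined by `D_y`. This file types the two printed sentences that anchor the record and restates
Prop. 1.4 (iii) over anchored points:
* `AnchoredPoint E` = `NonCuspidalPoint E` + `evalAt_injective` ("`H¹(G_L, Δ_Θ) ≅ (L^×)^∧`", p. 22) +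
  `evalAt_logUdd` ("Kummer classes … regarded as a regular function on `Ÿ`", p. 22: the Kummer class
  `log(Ü)` of the coordinate FUNCTION restricts at `y` to the Kummer class of the VALUE `Ü(y)`), whence
  `AnchoredPoint.coord_unique` — the coordinate is DETERMINED by `(D_y, evalAt)` and the shift is gone;
* `Prop14iiiValuesAnchored E` — the corrected form of F-0590 (same wording, anchored points); it is
  implied by the struck `Prop14iiiValues` (`prop14iiiValuesAnchored_of_prop14iiiValues`), i.e. strictly
  a weakening of the typed fact, and it is NOT asserted;
* `MuTwoSetting.AnchoredStandardData` — Def. 1.9's `τ`, `τ⁻¹` as anchored points, with the forgetful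
  map to `StandardData`.
Nothing here is consumed tonight (D-0067); consumers keep the "law on the points used" shapes
(abc-iut-L2-t6 / abc-iut-w5-d140). HONEST FRAMING: typed ≠ proved; [EtTh] is refereed and nothing of it
is asserted; no side is taken on [IUTchIII] Cor. 3.12.
-/

noncomputable section

namespace Literature.AnabelianGeometry.EtaleTheta

open Literature.AnabelianGeometry.SemiGraphs

namespace ThetaSetting

variable {p : ℕ} [Fact p.Prime] {D : ThetaSetting p}

/-! ### Anchored non-cuspidal points -/

/-- An **anchored non-cuspidal point** `y` of `Ÿ` over `K̈`: a `NonCuspidalPoint` (decomposition group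
`D_y ≤ Π^tp_Ÿ`, coordinate `Ü(y) ∈ K̈^×`, evaluation `H¹(D_y, Δ_Θ) → (K̈^×)^∧`) TOGETHER WITH the two
printed sentences tying these data to one another: "the restricted classes … `∈ H¹(G_L, Δ_Θ) ≅
H¹(G_L, Ẑ(1)) ≅ (L^×)^∧`" (the evaluation is injective) and — "the 'Kummer classes' … regarded as a
regular function on `Ÿ`" restricted to the point — the Kummer class `log(Ü)` of the coordinate function
evaluates at `y` to the value `Ü(y)` (Prop. 1.4 (iii), p. 22). [cite: MochizukiEtTh2009, Prop 1.4 (iii) p.22] -/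
structure AnchoredPoint (E : D.KummerData) extends NonCuspidalPoint E where
  /-- "`H¹(G_L, Δ_Θ) ≅ H¹(G_L, Ẑ(1)) ≅ (L^×)^∧`" (p. 22): the evaluation map is injective. -/
  evalAt_injective : Function.Injective evalAt
  /-- `log(Ü)|_y = Ü(y)`: the Kummer class of the coordinate `Ü` (`KummerData.logUdd`, "the Kummer class
  of … `Ü ∈ Γ(Ü, O^×_Ü)`", p. 21) restricted to `D_y` evaluates to the coordinate of the point (p. 22). -/
  evalAt_logUdd :
    evalAt (ContH1.res D.toTheta D.DeltaTheta Dpt_le (D.inflTheta D.GtpYdd E.logUdd)) = E.toKddHat coord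

namespace AnchoredPoint

variable {E : D.KummerData}

/-- **The coordinate of an anchored point is determined by its decomposition group and evaluation map**:
any `c ∈ K̈^×` to which `log(Ü)|_y` evaluates equals `Ü(y)` — so the re-coordinatisation
`(D_y, q̈·Ü(y), evalAt)` behind the vacuity of F-0590 is not an anchored point.
[cite: MochizukiEtTh2009, Prop 1.4 (iii) p.22] -/
theorem coord_unique (y : AnchoredPoint E) {c : (↥D.Kdd)ˣ}
    (hc : y.evalAt (ContH1.res D.toTheta D.DeltaTheta y.Dpt_le (D.inflTheta D.GtpYdd E.logUdd)) =
      E.toKddHat c) : c = y.coord :=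
  E.toKddHat_injective (hc.symm.trans y.evalAt_logUdd)

/-- Two anchorings of the same underlying record agree on nothing new: the anchoring is a PROPERTY of
`(D_y, Ü(y), evalAt)` (proof-irrelevant fields). [cite: MochizukiEtTh2009, Prop 1.4 (iii) p.22] -/
theorem ext_of_toNonCuspidalPoint_eq {y y' : AnchoredPoint E}
    (h : y.toNonCuspidalPoint = y'.toNonCuspidalPoint) : y = y' := by
  cases y; cases y'
  cases h
  rfl

end AnchoredPoint

/-! ### Prop. 1.4 (iii), corrected form over anchored points -/

/-- **Prop. 1.4 (iii), values — CORRECTED FORM of FACT-LIST F-0590** (p. 22): "if … `y ∈ Ÿ(L)` is a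
non-cuspidal point, then the restricted classes `O^×_K̈ · η̈^Θ|_y ∈ H¹(G_L, Δ_Θ) ≅ … ≅ (L^×)^∧ … lie in
`L^× ⊆ (L^×)^∧` and are equal to the values `O^×_K̈ · Θ̈(y)`" — here for `L = K̈`, over ANCHORED points
(`AnchoredPoint`), with `Θ̈(y)` the series of Prop. 1.4 at `Ü(y)`. Same wording as the struck
`Prop14iiiValues` (which quantified over un-anchored records and therefore holds only vacuously); NOT
asserted. [cite: MochizukiEtTh2009, Prop 1.4 (iii) p.22] -/
def Prop14iiiValuesAnchored (E : D.EtaleThetaData) : Prop :=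
  ∀ (y : AnchoredPoint E.toKummerData) (x : D.H1 D.GtpYdd), x ∈ E.thetaClasses →
    ∃ (a : (↥D.Kdd)ˣ) (_ : a ∈ D.unitsOKdd) (v : (↥D.Kdd)ˣ),
      ((v : D.Kdd) : PadicAlgCl p) = thetaDdot D.qdd ((y.coord : D.Kdd) : PadicAlgCl p) ∧
      y.evalAt (ContH1.res D.toTheta D.DeltaTheta y.Dpt_le x) = E.toKddHat (a * v)

/-- The corrected form is IMPLIED by the struck `∀`-form (it quantifies over fewer records) — so it is a
weakening of what was typed, not a new claim. [cite: MochizukiEtTh2009, Prop 1.4 (iii) p.22] -/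
theorem prop14iiiValuesAnchored_of_prop14iiiValues {E : D.EtaleThetaData} (h : Prop14iiiValues E) :
    Prop14iiiValuesAnchored E :=
  fun y x hx => h y.toNonCuspidalPoint x hx

end ThetaSetting

/-! ### Def. 1.9: anchored standard data -/

namespace MuTwoSetting

variable {p : ℕ} [Fact p.Prime] (M : MuTwoSetting p)

/-- **Def. 1.9 data with anchored points** (p. 29): "`√−1` determines a 4-torsion point `τ` … the
4-torsion point `τ⁻¹` determined by `−√−1`", as ANCHORED non-cuspidal points of `Ÿ` with coordinates
`Ü(τ) = √−1`, `Ü(τ⁻¹) = (√−1)⁻¹` — the anchored refinement of `StandardData`.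
[cite: MochizukiEtTh2009, Def 1.9 p.29] -/
structure AnchoredStandardData (E : M.toThetaSetting.KummerData) where
  /-- `√−1 ∈ K = K̈` (p. 29), as an element of `ℚ̄_p` … -/
  sqrtNegOne : PadicAlgCl p
  /-- … lying in `K` … -/
  sqrtNegOne_mem : sqrtNegOne ∈ M.K
  /-- … with `(√−1)² = −1`. -/
  sqrtNegOne_sq : sqrtNegOne ^ 2 = -1
  /-- the anchored point `τ` over the 4-torsion point determined by `√−1` -/
  tau : ThetaSetting.AnchoredPoint E
  /-- the anchored point `τ⁻¹` determined by `−√−1` -/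
  tauInv : ThetaSetting.AnchoredPoint E
  /-- `Ü(τ) = √−1` -/
  tau_coord : ((tau.coord : M.Kdd) : PadicAlgCl p) = sqrtNegOne
  /-- `Ü(τ⁻¹) = (√−1)⁻¹` -/
  tauInv_coord : ((tauInv.coord : M.Kdd) : PadicAlgCl p) = sqrtNegOne⁻¹

variable {M}

/-- Forget the anchoring: anchored standard data are standard data (Def. 1.9).
[cite: MochizukiEtTh2009, Def 1.9 p.29] -/
def AnchoredStandardData.toStandardData {E : M.toThetaSetting.KummerData}
    (S : M.AnchoredStandardData E) : M.StandardData E where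
  sqrtNegOne := S.sqrtNegOne
  sqrtNegOne_mem := S.sqrtNegOne_mem
  sqrtNegOne_sq := S.sqrtNegOne_sq
  tau := S.tau.toNonCuspidalPoint
  tauInv := S.tauInv.toNonCuspidalPoint
  tau_coord := S.tau_coord
  tauInv_coord := S.tauInv_coord

/-- [cite: MochizukiEtTh2009, Def 1.9 p.29] -/
theorem AnchoredStandardData.toStandardData_tau {E : M.toThetaSetting.KummerData}
    (S : M.AnchoredStandardData E) : S.toStandardData.tau = S.tau.toNonCuspidalPoint := rfl

/-- [cite: MochizukiEtTh2009, Def 1.9 p.29] -/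
theorem AnchoredStandardData.toStandardData_tauInv {E : M.toThetaSetting.KummerData}
    (S : M.AnchoredStandardData E) : S.toStandardData.tauInv = S.tauInv.toNonCuspidalPoint := rfl

end MuTwoSetting

end Literature.AnabelianGeometry.EtaleTheta

end
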